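import Mathlib.LinearAlgebra.FiniteDimensional.Lemmas
import Mathlib.LinearAlgebra.Dimension.RankNullity
import Mathlib.LinearAlgebra.Matrix.Rank
import Literature.Topology.FourManifolds.LeeRasmussen
import Literature.Topology.FourManifolds.LeeRasmussenContractionProofs
import HarnessLib

/-!
# Lee's theorem in degree zero: `Kh'⁰` of a knot diagram has rank two
(reduction to the merge/split dichotomy)

Sibling file of `LeeRasmussen.lean`. Main result:

* `finrank_leeHomologyZero_eq_two_of_dichotomy` — **the named fact
  `finrank_leeHomologyZero_eq_two` (Lee (2005), Thm. 4.2 in degree `0`: for a knot diagram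
  `Kh'⁰ ≅ ℚ ⊕ ℚ`) follows from the named fact `isMergeAt_or_isSplitAt_of_hasGaussDiagram` of
  `KhResolutions`** (every edge of the cube of a realisable Gauss diagram is a merge or a split —
  the planarity input, Jordan curve theorem). All the algebra is proved:
  `Kh'⁰ = ker d₀ ⧸ (im d₋₁ ⊓ ker d₀)` for Lee's differential `d = khovanovD ℚ 0 1`; in Lee's
  coordinates (`leeCoord`, `LeeRasmussenBasisProofs`) `d` becomes the label-preserving matrix
  `D` (`leeCoord_comp_khovanovD`, `LeeRasmussenTwistProofs`), which is contracted off Lee's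
  canonical generators by `D H + H D = 1 - Π` (`LeeRasmussenContractionProofs`); with `d² = 0`
  (`khovanovD_comp_khovanovD_of_isMergeAt_or_isSplitAt`, `KhComplexFaceProofs`) this gives
  `ker d₀ = im d₋₁ ⊕ im π` and `dim Kh'⁰ = rank Π₀ =` the number of degree-`0` generators with no
  free chord `= 2` (`card_noFree_degStates_zero`, `LeeRasmussenLabProofs`, using Gauss parity,
  `overPos_mod_two_ne_of_dichotomy`).
* `finrank_ker_quotient_eq_of_homotopy` — the abstract linear algebra: for `Vm →ᴬ V₀ →ᴮ Vp`
  with `B A = 0` and maps `h₀, h₁, π` with `A h₀ + h₁ B = 1 - π`, `π A = 0`, `B π = 0`, `π² = π`,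
  `dim (ker B ⧸ im A) = rank π`.

## References

* E. S. Lee, *An endomorphism of the Khovanov invariant*, Adv. Math. 197 (2005) 554–586,
  Thm. 4.2 (`H(L)` has rank `2ⁿ` for an `n`-component link; for a knot the two generators lie in
  degree `0`, Prop. 4.3). [cite: Lee2005, Thm. 4.2]
* J. Rasmussen, *Khovanov homology and the slice genus*, Invent. Math. 182 (2010), Thm. 2.2,
  §2.3. [cite: Rasmussen2010, §2.3]
-/

open Function Set Matrix

noncomputable section

namespace Literature.Topology.FourManifolds

/-! ## Abstract linear algebra: homology of a contracted complex -/

/-- **Homology of a complex contracted off a projector.** Let `Vm →ᴬ V₀ →ᴮ Vp` be linear maps of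
finite-dimensional vector spaces with `B ∘ A = 0`, and let `h₀ : V₀ → Vm`, `h₁ : Vp → V₀`,
`π : V₀ → V₀` satisfy `A h₀ + h₁ B = 1 - π`, `π A = 0`, `B π = 0`, `π² = π`. Then
`ker B = im A ⊕ im π`, so the homology `ker B ⧸ im A` has dimension `rank π`.
(Standard: a chain homotopy between the identity and a projector.) [folklore] -/
theorem finrank_ker_quotient_eq_of_homotopy {K : Type*} [Field K] {Vm V₀ Vp : Type*}
    [AddCommGroup Vm] [Module K Vm] [AddCommGroup V₀] [Module K V₀] [AddCommGroup Vp]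
    [Module K Vp] [FiniteDimensional K V₀]
    (A : Vm →ₗ[K] V₀) (B : V₀ →ₗ[K] Vp) (h₀ : V₀ →ₗ[K] Vm) (h₁ : Vp →ₗ[K] V₀) (π : V₀ →ₗ[K] V₀)
    (hBA : B ∘ₗ A = 0) (hh : ∀ x, A (h₀ x) + h₁ (B x) = x - π x) (hπA : ∀ y, π (A y) = 0)
    (hBπ : ∀ x, B (π x) = 0) (hππ : ∀ x, π (π x) = π x) :
    Module.finrank K (↥(LinearMap.ker B) ⧸
        (LinearMap.range A).comap (LinearMap.ker B).subtype) =
      Module.finrank K (LinearMap.range π) := by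
  have hle : LinearMap.range A ≤ LinearMap.ker B := LinearMap.range_le_ker_iff.2 hBA
  have hπle : LinearMap.range π ≤ LinearMap.ker B := by
    rintro _ ⟨x, rfl⟩
    exact hBπ x
  -- `ker B = im A ⊔ im π`
  have hsup : LinearMap.ker B = LinearMap.range A ⊔ LinearMap.range π := by
    apply le_antisymm
    · intro z hz
      rw [LinearMap.mem_ker] at hz
      have h1 := hh z
      rw [hz, map_zero, add_zero] at h1
      have h2 : z = A (h₀ z) + π z := by rw [h1]; abel
      rw [h2]
      exact Submodule.add_mem_sup ⟨_, rfl⟩ ⟨_, rfl⟩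
    · exact sup_le hle hπle
  -- `im A ⊓ im π = 0`
  have hinf : LinearMap.range A ⊓ LinearMap.range π = ⊥ := by
    rw [Submodule.eq_bot_iff]
    rintro y ⟨⟨x, rfl⟩, ⟨w, hw⟩⟩
    have h1 : π (A x) = A x := by rw [← hw, hππ]
    rw [← h1, hπA]
  have h1 := Submodule.finrank_quotient_add_finrank
    ((LinearMap.range A).comap (LinearMap.ker B).subtype)
  have h2 : Module.finrank K ((LinearMap.range A).comap (LinearMap.ker B).subtype) =
      Module.finrank K (LinearMap.range A) :=
    LinearEquiv.finrank_eq (Submodule.comapSubtypeEquivOfLe hle)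
  have h3 := Submodule.finrank_sup_add_finrank_inf_eq (LinearMap.range A) (LinearMap.range π)
  rw [hinf, finrank_bot, add_zero, ← hsup] at h3
  omega

namespace GaussDiagram

variable {G : GaussDiagram}

/-! ## Lee's differential, homotopy and projector, back in the original coordinates -/

/-- Pointwise intertwining: `leeCoord (d x) = D (leeCoord x)`. [folklore] -/
theorem leeCoord_khovanovD (k k' : ℤ) (x : G.degStates k → ℚ) :
    G.leeCoord k' (G.khovanovD ℚ 0 1 k k' x) =
      Matrix.toLin' (G.leeDiffMat k k') (G.leeCoord k x) :=
  LinearMap.congr_fun (leeCoord_comp_khovanovD k k') x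

/-- Pointwise intertwining through the inverse: `d (leeCoord⁻¹ z) = leeCoord⁻¹ (D z)`. [folklore] -/
theorem khovanovD_leeCoord_symm (k k' : ℤ) (z : G.degStates k → ℚ) :
    G.khovanovD ℚ 0 1 k k' ((G.leeCoord k).symm z) =
      (G.leeCoord k').symm (Matrix.toLin' (G.leeDiffMat k k') z) := by
  rw [LinearEquiv.eq_symm_apply, leeCoord_khovanovD, LinearEquiv.apply_symm_apply]

/-- **The rank of the projector onto Lee's canonical generators in degree `0` is two** (given
the merge/split dichotomy, through Gauss parity): it is the diagonal `0/1` matrix supported on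
the degree-`0` generators with no free chord, of which there are exactly two
(`card_noFree_degStates_zero`). Lee (2005), Thm. 4.2. [cite: Lee2005, Thm. 4.2] -/
theorem finrank_range_leeProjMat_zero
    (hD : ∀ (σ : G.State) (i : Fin G.n), σ i = false → G.IsMergeAt σ i ∨ G.IsSplitAt σ i) :
    Module.finrank ℚ (LinearMap.range (Matrix.toLin' (G.leeProjMat 0))) = 2 := by
  classical
  have hpar : ∀ i : Fin G.n, (G.overPos i).val % 2 ≠ (G.underPos i).val % 2 :=
    overPos_mod_two_ne_of_dichotomy hD
  have h1 : Module.finrank ℚ (LinearMap.range (Matrix.toLin' (G.leeProjMat 0))) =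
      (G.leeProjMat 0).rank := by
    rw [Matrix.rank, Matrix.toLin'_apply']
  rw [h1, leeProjMat, Matrix.rank_diagonal]
  rw [← card_noFree_degStates_zero hpar, Nat.card_eq_fintype_card]
  refine Fintype.card_congr (Equiv.subtypeEquivRight fun s ↦ ?_)
  constructor
  · intro h
    by_contra hf
    exact h (if_neg hf)
  · intro h
    rw [if_pos h]
    exact one_ne_zero

/-- **Lee's theorem in degree zero, from the merge/split dichotomy.** If every edge of the cube
of resolutions of every realisable Gauss diagram is a merge or a split (the named fact
`isMergeAt_or_isSplitAt_of_hasGaussDiagram` of `KhResolutions`, for all `G`), then for every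
realisable Gauss diagram Lee homology in homological degree `0` is two-dimensional over `ℚ`
(the named fact `finrank_leeHomologyZero_eq_two`): `Kh'⁰ = ker d₀ ⧸ (im d₋₁ ⊓ ker d₀)` is
conjugated by Lee's coordinates to the label-preserving complex, which is chain-contracted off
Lee's two canonical generators (`leeDiffMat_mul_leeHtpyMat_add`, `finrank_ker_quotient_eq_of_homotopy`,
`finrank_range_leeProjMat_zero`); `d² = 0` is `khovanovD_comp_khovanovD_of_isMergeAt_or_isSplitAt`.
E. S. Lee (2005), Thm. 4.2; Rasmussen (2010), Thm. 2.2, §2.3. [cite: Lee2005, Thm. 4.2] -/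
theorem finrank_leeHomologyZero_eq_two_of_dichotomy
    (hD : ∀ G : GaussDiagram, isMergeAt_or_isSplitAt_of_hasGaussDiagram (G := G)) :
    finrank_leeHomologyZero_eq_two := by
  intro G hG
  have hms : ∀ (σ : G.State) (i : Fin G.n), σ i = false → G.IsMergeAt σ i ∨ G.IsSplitAt σ i :=
    fun _ _ h ↦ hD G hG h
  -- the maps, in the original coordinates
  set Ψm := G.leeCoord (0 - 1) with hΨm
  set Ψ₀ := G.leeCoord 0 with hΨ₀
  set Ψp := G.leeCoord (0 + 1) with hΨp
  set A := G.khovanovD ℚ 0 1 (0 - 1) 0 with hA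
  set B := G.khovanovD ℚ 0 1 0 (0 + 1) with hB
  set h₀ : (G.degStates 0 → ℚ) →ₗ[ℚ] (G.degStates (0 - 1) → ℚ) :=
    Ψm.symm.toLinearMap ∘ₗ Matrix.toLin' (G.leeHtpyMat 0 (0 - 1)) ∘ₗ Ψ₀.toLinearMap with hh₀
  set h₁ : (G.degStates (0 + 1) → ℚ) →ₗ[ℚ] (G.degStates 0 → ℚ) :=
    Ψ₀.symm.toLinearMap ∘ₗ Matrix.toLin' (G.leeHtpyMat (0 + 1) 0) ∘ₗ Ψp.toLinearMap with hh₁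
  set π : (G.degStates 0 → ℚ) →ₗ[ℚ] (G.degStates 0 → ℚ) :=
    Ψ₀.symm.toLinearMap ∘ₗ Matrix.toLin' (G.leeProjMat 0) ∘ₗ Ψ₀.toLinearMap with hπ
  have hBA : B ∘ₗ A = 0 :=
    khovanovD_comp_khovanovD_of_isMergeAt_or_isSplitAt G ℚ hms 0 1 (0 - 1)
  have hh : ∀ x, A (h₀ x) + h₁ (B x) = x - π x := by
    intro x
    simp only [hh₀, hh₁, hπ, hA, hB, LinearMap.coe_comp, Function.comp_apply,
      LinearEquiv.coe_coe]
    rw [khovanovD_leeCoord_symm, leeCoord_khovanovD, ← map_add, ← Matrix.toLin'_mul_apply,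
      ← Matrix.toLin'_mul_apply, ← LinearMap.add_apply, ← map_add,
      leeDiffMat_mul_leeHtpyMat_add hms 0, map_sub, Matrix.toLin'_one, LinearMap.sub_apply,
      LinearMap.id_apply, map_sub, LinearEquiv.symm_apply_apply]
  have hπA : ∀ y, π (A y) = 0 := by
    intro y
    simp only [hπ, hA, LinearMap.coe_comp, Function.comp_apply, LinearEquiv.coe_coe]
    rw [leeCoord_khovanovD, ← Matrix.toLin'_mul_apply, leeProjMat_mul_leeDiffMat, map_zero,
      LinearMap.zero_apply, map_zero]
  have hBπ : ∀ x, B (π x) = 0 := by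
    intro x
    simp only [hπ, hB, LinearMap.coe_comp, Function.comp_apply, LinearEquiv.coe_coe]
    rw [khovanovD_leeCoord_symm, ← Matrix.toLin'_mul_apply, leeDiffMat_mul_leeProjMat, map_zero,
      LinearMap.zero_apply, map_zero]
  have hππ : ∀ x, π (π x) = π x := by
    intro x
    simp only [hπ, LinearMap.coe_comp, Function.comp_apply, LinearEquiv.coe_coe]
    rw [LinearEquiv.apply_symm_apply, ← Matrix.toLin'_mul_apply, leeProjMat_mul_leeProjMat]
  have hrank : Module.finrank ℚ (LinearMap.range π) = 2 := by
    have hr : LinearMap.range π =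
        (LinearMap.range (Matrix.toLin' (G.leeProjMat 0))).map Ψ₀.symm.toLinearMap := by
      rw [hπ, LinearMap.range_comp, LinearMap.range_comp, LinearEquiv.range, Submodule.map_top]
    rw [hr, LinearEquiv.finrank_map_eq]
    exact finrank_range_leeProjMat_zero hms
  change Module.finrank ℚ (↥(LinearMap.ker B) ⧸ (LinearMap.range A).comap (LinearMap.ker B).subtype) = 2
  rw [finrank_ker_quotient_eq_of_homotopy A B h₀ h₁ π hBA hh hπA hBπ hππ, hrank]

end GaussDiagram

end Literature.Topology.FourManifolds
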